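import Summits.NavierStokesRegularity.OSWSelfSimilar.SheetRPerturbedResolventC
import Summits.NavierStokesRegularity.OSWSelfSimilar.SheetRPerturbedResolvent
import HarnessLib

/-!
# SHEET-ℝ frame, (P1): DICTIONARY between the resolvent chains — the local resolvent `R(σ)` (`SheetRResolventComplex`, datum
# `GardingData`) and the perturbed resolvent `R_K(σ)` of record (`SheetRPerturbedResolvent`, datum `GardingDataK`, coefficient `1`) ARE the
# general-coefficient resolvent `resolventKC` (`SheetRPerturbedResolventC`) at the embedded data

HONEST FRAMING (cell ns-blowup GROUP B / zone Z3, case Z3-SR-SPEC, PAPER item (P1); 1-D MODEL certificate frame (viscous gCLM/OSW sheet on the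
line); not Euler/NS; «violates: none — MODEL»). Nothing here asserts that a profile exists; all Gårding data are HYPOTHESES.

The tree now holds three constructions of «the» resolvent by choice from Lions' theorem: `resolvent hL h σ` (`h : GardingData`, no perturbation),
`resolventK hL K h σ` (`h : GardingDataK`, `‖v₁‖²_w`-coefficient `1`) and `resolventKC hL K h σ` (`h : GardingDataKC`, coefficient `c > 0`).  By weak
UNIQUENESS they coincide on the embedded data, so every statement proved for `resolventKC` (resolvent identity, sharp bound, odd-class closed
operator) transfers to the two older objects by rewriting:

* `GardingData.toKC0` — a `GardingData` datum is a `GardingDataKC` datum with `K = 0`, `c = 1` (`integral_weight_zeroK`: the `K`-term vanishes);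
* `pairOpKC_toKC`, **`resolventKC_toKC`**: `resolventKC hL K h.toKC σ = resolventK hL K h σ` for `h : GardingDataK`;
* `pairOpKC_toKC0`, **`resolventKC_toKC0`**: `resolventKC hL 0 (h.toKC0 hL) σ = resolvent hL h σ` for `h : GardingData`.
Pure functional analysis; no definition, no named fact.  WHAT THIS IS NOT: not NS; no number of record moves.
-/

noncomputable section

namespace Summit.NavierStokesRegularity.OSWSelfSimilar
namespace SheetRResolventDictionary

open _root_.MeasureTheory _root_.Set _root_.Filter _root_.Real SheetRWeakProfilePV SheetRWeakToStrong SheetREnergyClass SheetRWeightedMeasure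
  SheetRLinearisedTests SheetREnergySpace SheetRTestSpace SheetRLinearisedFormBounds SheetRSolutionOperator SheetRLinearisedCutoffEnergy
  SheetRResolventPair SheetRComplexPivot SheetRResolventComplex SheetRPerturbedUniqueness SheetRPerturbedPair SheetRPerturbedResolvent
  SheetRPerturbedResolventC Literature.Analysis.OperatorTheory
open scoped Topology ENNReal

variable {L D₀ D₁ V₀ m : ℝ} {d V : ℝ → ℝ}

/-! ### §1 The perturbed resolvent of record (coefficient `1`) -/

/-- `pairOpKC` at the embedded datum `h.toKC` is `pairOpK` (weak uniqueness). [folklore] -/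
theorem pairOpKC_toKC (hL : 0 < L) (K : Esp L hL →L[ℝ] W L) (h : GardingDataK L hL d V K D₀ D₁ V₀ m) (σ : ℂ) (hσ : -m < σ.re) :
    pairOpKC hL K h.toKC σ hσ = pairOpK hL K h σ hσ := by
  refine ContinuousLinearMap.ext fun G => ?_
  exact (pairOpKC_unique hL K h.toKC σ hσ G ((pairOpK_spec hL K h σ hσ).1 G)).symm

/-- **`resolventKC hL K h.toKC σ = resolventK hL K h σ`** for every `σ`. [folklore] -/
theorem resolventKC_toKC (hL : 0 < L) (K : Esp L hL →L[ℝ] W L) (h : GardingDataK L hL d V K D₀ D₁ V₀ m) (σ : ℂ) :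
    resolventKC hL K h.toKC σ = resolventK hL K h σ := by
  refine ContinuousLinearMap.ext fun G => ?_
  by_cases hσ : -m < σ.re
  · rw [resolventKC_apply, resolventRKC_apply hL K h.toKC hσ, resolventK_apply, resolventRK_apply hL K h hσ, pairOpKC_toKC]
  · rw [resolventKC_apply, resolventRKC_of_not hL K h.toKC hσ, resolventK_apply, resolventRK_of_not hL K h hσ]

/-! ### §2 The local resolvent (`K = 0`) -/

/-- The `K`-term of the perturbed weak form vanishes for `K = 0`. [folklore] -/
theorem integral_weight_zeroK (hL : 0 < L) (p : Esp L hL) (v : ℝ → ℝ) :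
    ∫ y, (L ^ 2 + y ^ 2) * (((((0 : Esp L hL →L[ℝ] W L) p) : W L) : ℝ → ℝ) y * v y) = 0 := by
  have h0 : ((((0 : Esp L hL →L[ℝ] W L) p) : W L) : ℝ → ℝ) =ᵐ[volume] (0 : ℝ → ℝ) :=
    ae_volume_of_ae_μw hL (Lp.coeFn_zero ℝ 2 (μw L))
  have : (fun y => (L ^ 2 + y ^ 2) * (((((0 : Esp L hL →L[ℝ] W L) p) : W L) : ℝ → ℝ) y * v y)) =ᵐ[volume] fun _ => (0 : ℝ) := by
    filter_upwards [h0] with y hy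
    rw [hy, Pi.zero_apply, zero_mul, mul_zero]
  rw [integral_congr_ae this, integral_zero]

/-- A `GardingData` datum (no perturbation) is a `GardingDataKC` datum with `K = 0`, `c = 1`. [folklore] -/
theorem _root_.Summit.NavierStokesRegularity.OSWSelfSimilar.SheetRResolventComplex.GardingData.toKC0 (hL : 0 < L)
    (h : GardingData L d V D₀ D₁ V₀ m) : GardingDataKC L hL d V (0 : Esp L hL →L[ℝ] W L) D₀ D₁ V₀ 1 m where
  d_meas := h.d_meas
  V_meas := h.V_meas
  D₀_nonneg := h.D₀_nonneg
  D₁_nonneg := h.D₁_nonneg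
  d_le := h.d_le
  V_le := h.V_le
  c_pos := one_pos
  garding vp := by
    rw [one_mul, integral_weight_zeroK hL, add_zero]
    exact h.garding vp.1.1 vp.1.2 vp.2

/-- `pairOpKC` at `K = 0` and the embedded datum is the local `pairOp` (weak uniqueness). [folklore] -/
theorem pairOpKC_toKC0 (hL : 0 < L) (h : GardingData L d V D₀ D₁ V₀ m) (σ : ℂ) (hσ : -m < σ.re) :
    pairOpKC hL 0 (h.toKC0 hL) σ hσ = pairOp hL h σ hσ := by
  refine ContinuousLinearMap.ext fun G => ?_
  refine (pairOpKC_unique hL 0 (h.toKC0 hL) σ hσ G fun v v₁ hv => ?_).symm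
  obtain ⟨e1, e2⟩ := (pairOp_spec hL h σ hσ).1 G v v₁ hv
  rw [integral_weight_zeroK hL, add_zero, integral_weight_zeroK hL, add_zero]
  exact ⟨e1, e2⟩

/-- **`resolventKC hL 0 (h.toKC0 hL) σ = resolvent hL h σ`** for every `σ`: the local resolvent is the `K = 0` case. [folklore] -/
theorem resolventKC_toKC0 (hL : 0 < L) (h : GardingData L d V D₀ D₁ V₀ m) (σ : ℂ) :
    resolventKC hL 0 (h.toKC0 hL) σ = resolvent hL h σ := by
  refine ContinuousLinearMap.ext fun G => ?_
  by_cases hσ : -m < σ.re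
  · rw [resolventKC_apply, resolventRKC_apply hL 0 (h.toKC0 hL) hσ, resolvent_apply, resolventR_apply hL h hσ, pairOpKC_toKC0]
  · rw [resolventKC_apply, resolventRKC_of_not hL 0 (h.toKC0 hL) hσ, resolvent_apply, resolventR_of_not hL h hσ]

end SheetRResolventDictionary
end Summit.NavierStokesRegularity.OSWSelfSimilar

end
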